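import Summits.QuantumFields.BalabanUV.Beta.EriceRemainderEnclosureHistoryAutonomyComparisonTowerChainFourLemmas

/-!
# EriceRemainderEnclosureHistoryAutonomyComparisonTowerChainFour — (E66b) THE WINDOW BUDGET CLOSES THE DUAL CHAIN ON TOWERS OF RATIO `≥ 4`, BY A HYPERBOLIC
# INVARIANT: `λ_k = 4Z_k∕(2 − Z_k)` (`Z_k = Σ_{s≤k} x_s√(s∕k)`, the young pressure in the chain's currency) replaces the linear `λ_k = 4Z_k` of (E65g)∕(E65i).
# The reachable set of the λ-chain under the window budget has a CONVEX upper envelope `λ ≤ h(Z)` pinned to the lone-age curve `Z∕(1 − 3Z∕4)` (numerics,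
# README); no linear invariant closes below ratio `6`, the hyperbola `4Z∕(2 − Z)` closes at `4` — after the reduction to the extreme transport `s = √(k⁻∕k) = 1∕2`
# (legitimate because the transported defect bound `8Zs²∕(2 − Z)` is at most `2u∕(1 − u)`, `u = sZ`, for `s ≤ 1∕2`, `Z ≤ 1`) the step is ONE cubic inequality in
# two variables ((E66a) `step_poly4`, Handelman-certified).  With (E65f): towers of pairwise ratio `≥ 4`, ANY height, ANY sizes and Markov weight compare
# ((E66c); (E65j): `6`, (E65h): `10`, (E64h): `14`)

Cell `pub-balaban`, β-function sub-cell, BINDER row D4 «RemainderConst leaves for Bałaban's split» (`HOME/BINDER-OWNERS.md`; owner lineage `b2b-balaban-beta-an4`;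
this file by co-owner #2 lineage `b2b-balaban-beta-d4-p2`, generation 59), β-FLOW TEAM duty (1), FREEZE (0) honoured (def-free; (E66a)'s `step_poly4` ∕
`cond_poly4` ∕ `load_le_of_window_budget` ∕ `budget_line_of_tower_four` BY NAME).

HONEST FRAMING (page 1, verbatim and binding).  *"Discharging BetaPertH makes Bałaban's UV stability UNCONDITIONAL — a real constructive-QFT result; it is
NOT the continuum limit and NOT the Clay problem."*  THIS FILE DISCHARGES NOTHING OF THE KIND.  A lemma about finitely many non-negative reals; its use is
through (E65f), whose hypotheses are those of a census, not facts; nothing of Bałaban's is asserted.  Row D4 class UNCHANGED (critical-path width 0; instance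
0∕1; D4 DISCHARGE NO DATE).  HONEST DEPENDENCY: continuum YM on T⁴ ⇐ BetaPertH ∧ nine spine estimates (0/9 proved); BetaPertH ⇐ (D1) ∧ (D4) ∧ CAP+tail;
G-an2-4 gates asym, D1 and NE2/3/4.

THE POINT (census sense (α); the COMPARISON column, conjecture (E58′), route (C″)).  The state of the λ-chain after an age is `(λ, Z)`; a step to the next age
`k` (ratio `r = k⁻∕k ≤ 1∕4`, load `x`) is admissible when the window budget at scale `k` holds, which gives the budget line `(200∕259)x + (120∕109)u ≤ 1∕2`,
`u = √r·Z_{k⁻}` ((E66a)); it maps `λ ↦ [rλ(1 + x∕4) + x(1 + 2rλ)]∕(1 − x(3∕4 + 2rλ))`, `Z ↦ x + u`.  The forward-reachable set of this system (value iteration,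
README `reach.py`) is bounded for ratio `≥ 4` with the lattice constants, its envelope `h(Z)` is convex (`h(Z)∕Z` from `1.0` to `2.1`), and the condition value
never exceeds `0.50`; the hyperbola `F(Z) = 4Z∕(2 − Z)` is a one-step invariant (`λ_{k⁻} ≤ F(Z_{k⁻}) ⟹ λ_k ≤ F(Z_k)`, margin `0.058(x+u)` after clearing
denominators).  NOT CLAIMED: ratios below `4` (ratio `3` needs one more piece of budget information — with the lattice constant `κ(3,9) = 0.934` no hyperbola
`cZ∕(1 − aZ)` is invariant; ratio `2` is not closed by the `(λ, Z)` system at all, README); anything printed.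

WHAT IS PROVED ([folklore]; 0 `def`, 0 sorry).  **`dual_chain_of_tower_four`**.
-/
noncomputable section
open Finset

namespace Summit.QuantumFields.BalabanUV.Beta.EriceRemainderEnclosureHistoryAutonomyComparisonTowerChainFour

open Summit.QuantumFields.BalabanUV.Beta.EriceRemainderEnclosureHistoryAutonomyComparisonTowerChainFourLemmas
  (step_poly4 cond_poly4 load_le_of_window_budget budget_line_of_tower_four)

/-! ## The dual chain on a tower of ratio `≥ 4` -/

set_option maxHeartbeats 800000 in
/-- **THE WINDOW BUDGET CLOSES THE DUAL CHAIN ON TOWERS OF RATIO `≥ 4`.**  `A` a finite set of ages `≥ 1` with minimum `m₀` and predecessor map `pred`,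
consecutive ratios `4·pred k ≤ k`; loads `x ≥ 0` obeying the WINDOW BUDGET of (E65a) at every scale `j = k ∈ A`: `Σ_{s∈A} x_s·W_k(s) ≤ 1∕2` (`W_k(s) = S_{s,k}∕k`
for `s ≤ k`, `S_{s,k}∕s` for `s > k`, `S_{s,k} = Σ_{l<k}√(s∕(s+l+1))`) — exactly what (E65b)∕(E65f) offer.  Then there are `μ, λ ≥ 0` on `A` satisfying every
inequality of the dual chain of (E65e) (as demanded by (E65f)): **`λ_k = 4Z_k∕(2 − Z_k)`**, `Z_k = Σ_{s≤k} x_s√(s∕k) ≤ 71∕100`, `μ` explicit.  Proof: the budget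
line of (E66a) at every non-minimal age; the transported defect bound `2λ_{k⁻}r = 8Z_{k⁻}r∕(2 − Z_{k⁻}) ≤ 2u∕(1 − u)` (`u = √r·Z_{k⁻}`, `√r ≤ 1∕2`); then (E66a)
`cond_poly4` and `step_poly4`. [folklore] -/
theorem dual_chain_of_tower_four {A : Finset ℕ} {x : ℕ → ℝ} {pred : ℕ → ℕ} {m₀ : ℕ}
    (hA1 : ∀ k ∈ A, 1 ≤ k) (hx : ∀ k ∈ A, 0 ≤ x k) (hm₀ : m₀ ∈ A) (hmin : ∀ k ∈ A, m₀ ≤ k)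
    (hpred : ∀ k ∈ A, k ≠ m₀ → pred k ∈ A ∧ pred k < k ∧ ∀ k'' ∈ A, k'' < k → k'' ≤ pred k)
    (hfour : ∀ k ∈ A, k ≠ m₀ → 4 * pred k ≤ k)
    (hbud : ∀ k ∈ A, ∑ s ∈ A, x s * (if s ≤ k then (∑ l ∈ range k, Real.sqrt ((s : ℝ) / ((s : ℝ) + l + 1))) / k
        else (∑ l ∈ range k, Real.sqrt ((s : ℝ) / ((s : ℝ) + l + 1))) / s) ≤ 1 / 2) :
    ∃ μ lam : ℕ → ℝ, (∀ k ∈ A, 0 ≤ μ k) ∧ (∀ k ∈ A, 0 ≤ lam k) ∧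
      3 / 4 * x m₀ ≤ μ m₀ * (1 - 3 / 4 * x m₀) ∧ x m₀ ≤ lam m₀ * (1 - 3 / 4 * x m₀) ∧
      (∀ k ∈ A, k ≠ m₀ →
        x k * (min (4 * (pred k : ℝ) * k / ((k : ℝ) + pred k) ^ 2 * μ (pred k)) (2 * lam (pred k) * ((pred k : ℝ) / k)) + 3 / 4) < 1) ∧
      (∀ k ∈ A, k ≠ m₀ →
        min (4 * (pred k : ℝ) * k / ((k : ℝ) + pred k) ^ 2 * μ (pred k)) (2 * lam (pred k) * ((pred k : ℝ) / k)) * (1 + x k) + 3 / 4 * x k ≤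
          μ k * (1 - x k * (3 / 4 + min (4 * (pred k : ℝ) * k / ((k : ℝ) + pred k) ^ 2 * μ (pred k)) (2 * lam (pred k) * ((pred k : ℝ) / k))))) ∧
      (∀ k ∈ A, k ≠ m₀ →
        lam (pred k) * ((pred k : ℝ) / k) * (1 + x k / 4) +
            x k * (1 + min (4 * (pred k : ℝ) * k / ((k : ℝ) + pred k) ^ 2 * μ (pred k)) (2 * lam (pred k) * ((pred k : ℝ) / k))) ≤
          lam k * (1 - x k * (3 / 4 + min (4 * (pred k : ℝ) * k / ((k : ℝ) + pred k) ^ 2 * μ (pred k)) (2 * lam (pred k) * ((pred k : ℝ) / k))))) := by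
  have hcap : ∀ k ∈ A, x k ≤ 71 / 100 := fun k hk => (load_le_of_window_budget hA1 hx hk (hbud k hk)).2
  obtain ⟨Z, hZ_def⟩ : ∃ Z : ℕ → ℝ, Z = fun k => ∑ s ∈ A.filter (fun s => s ≤ k), x s * Real.sqrt ((s : ℝ) / k) := ⟨_, rfl⟩
  have hZ0 : ∀ k, 0 ≤ Z k := fun k => by
    rw [hZ_def]; exact sum_nonneg fun s hs => mul_nonneg (hx s (mem_filter.mp hs).1) (Real.sqrt_nonneg _)
  obtain ⟨lam, hlam_def⟩ : ∃ lam : ℕ → ℝ, lam = fun k => 4 * Z k / (2 - Z k) := ⟨_, rfl⟩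
  obtain ⟨eb, heb_def⟩ : ∃ eb : ℕ → ℝ, eb = fun k => 2 * lam (pred k) * ((pred k : ℝ) / k) := ⟨_, rfl⟩
  obtain ⟨μ, hμ_def⟩ : ∃ μ : ℕ → ℝ, μ = fun k => if k = m₀ then (3 / 4 * x m₀) / (1 - 3 / 4 * x m₀)
      else (eb k * (1 + x k) + 3 / 4 * x k) / (1 - x k * (3 / 4 + eb k)) := ⟨_, rfl⟩
  have hZm : Z m₀ = x m₀ := by
    have hset : A.filter (fun s => s ≤ m₀) = {m₀} := by
      ext s; simp only [mem_filter, mem_singleton]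
      constructor
      · rintro ⟨hs, hsm⟩; exact le_antisymm hsm (hmin s hs)
      · rintro rfl; exact ⟨hm₀, le_rfl⟩
    have hm1 : (0 : ℝ) < m₀ := by exact_mod_cast hA1 m₀ hm₀
    rw [hZ_def]; simp only [hset, sum_singleton]
    rw [div_self hm1.ne', Real.sqrt_one, mul_one]
  have hsplit : ∀ k ∈ A, k ≠ m₀ → Z k = x k + Real.sqrt ((pred k : ℝ) / k) * Z (pred k) := by
    intro k hk hne
    obtain ⟨hpA, hplt, hpmax⟩ := hpred k hk hne
    have hkr : (0 : ℝ) < k := by exact_mod_cast hA1 k hk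
    have hpr : (0 : ℝ) < pred k := by exact_mod_cast hA1 _ hpA
    have hset2 : A.filter (fun s => s ≤ k) = insert k (A.filter (fun s => s ≤ pred k)) := by
      ext s; simp only [mem_filter, mem_insert]
      constructor
      · rintro ⟨hs, hsk⟩
        rcases lt_or_eq_of_le hsk with h | h
        · exact Or.inr ⟨hs, hpmax s hs h⟩
        · exact Or.inl h
      · rintro (rfl | ⟨hs, hsp⟩)
        · exact ⟨hk, le_rfl⟩
        · exact ⟨hs, hsp.trans hplt.le⟩
    have hnot : k ∉ A.filter (fun s => s ≤ pred k) := by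
      simp only [mem_filter, not_and, not_le]; exact fun _ => hplt
    rw [hZ_def]; simp only [hset2, sum_insert hnot]
    rw [div_self hkr.ne', Real.sqrt_one, mul_one, mul_sum]
    congr 1
    refine sum_congr rfl fun s hs => ?_
    have hs0 : (0 : ℝ) ≤ s := Nat.cast_nonneg s
    rw [show (s : ℝ) / k = (pred k : ℝ) / k * ((s : ℝ) / pred k) by field_simp, Real.sqrt_mul (by positivity)]
    ring
  -- the budget line of (E66a) at every non-minimal age, in terms of Z
  have hline : ∀ k ∈ A, k ≠ m₀ → x k * (200 / 259) + Real.sqrt ((pred k : ℝ) / k) * Z (pred k) * (120 / 109) ≤ 1 / 2 := by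
    intro k hk hne
    have := budget_line_of_tower_four hA1 hx hm₀ hmin hpred hfour hbud hk hne
    rw [hZ_def]; exact this
  -- every young pressure is at most 71/100
  have hZle : ∀ k ∈ A, Z k ≤ 71 / 100 := by
    intro k hk
    by_cases hkm : k = m₀
    · rw [hkm, hZm]; exact hcap m₀ hm₀
    · have hl := hline k hk hkm
      have hu0 : 0 ≤ Real.sqrt ((pred k : ℝ) / k) * Z (pred k) := mul_nonneg (Real.sqrt_nonneg _) (hZ0 _)
      rw [hsplit k hk hkm]
      nlinarith [hx k hk]
  have hlamk : ∀ k, lam k = 4 * Z k / (2 - Z k) := fun k => by rw [hlam_def]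
  have hlam0 : ∀ k ∈ A, 0 ≤ lam k := fun k hk => by
    have h1 := hZle k hk; have h2 := hZ0 k
    rw [hlamk]
    exact div_nonneg (by linarith) (by linarith)
  have heb0 : ∀ k ∈ A, k ≠ m₀ → 0 ≤ eb k := fun k hk hne => by
    obtain ⟨hpA, _, _⟩ := hpred k hk hne
    rw [heb_def]; have := hlam0 (pred k) hpA; positivity
  have hstep : ∀ k ∈ A, k ≠ m₀ →
      x k * (eb k + 3 / 4) < 1 ∧
      lam (pred k) * ((pred k : ℝ) / k) * (1 + x k / 4) + x k * (1 + eb k) ≤ lam k * (1 - x k * (3 / 4 + eb k)) := by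
    intro k hk hkm
    obtain ⟨hpA, hplt, hpmax⟩ := hpred k hk hkm
    have hkr : (0 : ℝ) < k := by exact_mod_cast hA1 k hk
    have hpr : (0 : ℝ) < pred k := by exact_mod_cast hA1 _ hpA
    have hxk := hx k hk
    have hZk := hsplit k hk hkm
    have hl := hline k hk hkm
    have hfour' : 4 * (pred k : ℝ) ≤ k := by exact_mod_cast hfour k hk hkm
    have hZp := hZle _ hpA
    have hZp0 := hZ0 (pred k)
    obtain ⟨s, hs_def⟩ : ∃ s : ℝ, s = Real.sqrt ((pred k : ℝ) / k) := ⟨_, rfl⟩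
    obtain ⟨u, hu_def⟩ : ∃ u : ℝ, u = s * Z (pred k) := ⟨_, rfl⟩
    have hs0 : 0 ≤ s := by rw [hs_def]; exact Real.sqrt_nonneg _
    have hss : s * s = (pred k : ℝ) / k := by rw [hs_def]; exact Real.mul_self_sqrt (by positivity)
    have hs2 : s ≤ 1 / 2 := by
      rw [hs_def, show (1 : ℝ) / 2 = Real.sqrt ((1 / 2) ^ 2) by rw [Real.sqrt_sq (by norm_num)]]
      apply Real.sqrt_le_sqrt
      rw [div_le_iff₀ hkr]; nlinarith
    have hu0 : 0 ≤ u := by rw [hu_def]; exact mul_nonneg hs0 hZp0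
    have hl' : x k * (200 / 259) + u * (120 / 109) ≤ 1 / 2 := by rw [hu_def, hs_def]; exact hl
    have hu1 : u ≤ 109 / 120 * (1 / 2 - 200 / 259 * x k) := by nlinarith
    have hul : u ≤ 109 / 240 := by nlinarith
    have hxc := hcap k hk
    have hden1 : 0 < 1 - u := by linarith
    have hden2 : 0 < 2 - (x k + u) := by linarith
    have hdenZ : 0 < 2 - Z (pred k) := by linarith
    have h1u : 1 - u ≠ 0 := hden1.ne'
    have h2xu : 2 - (x k + u) ≠ 0 := hden2.ne'
    have h2Z : 2 - Z (pred k) ≠ 0 := hdenZ.ne'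
    -- the transported defect bound and its monotone majorant 2u/(1-u)
    have hebk : eb k = 8 * Z (pred k) * (s * s) / (2 - Z (pred k)) := by
      rw [heb_def]; simp only; rw [hlamk, hss]; field_simp; ring
    have hkey : 4 * s * (1 - s * Z (pred k)) ≤ 2 - Z (pred k) := by
      have h1 : 0 ≤ 1 - 2 * s := by linarith
      have h2 : 0 ≤ 2 - Z (pred k) * (1 + 2 * s) := by nlinarith
      nlinarith [mul_nonneg h1 h2]
    have heb_le : eb k ≤ 2 * u / (1 - u) := by
      rw [hebk, div_le_div_iff₀ hdenZ hden1, hu_def]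
      have hsZ : 0 ≤ s * Z (pred k) := mul_nonneg hs0 hZp0
      nlinarith [mul_le_mul_of_nonneg_left hkey hsZ]
    -- the condition
    have hc := cond_poly4 hxk hu0 hu1
    have hcondbar : x k * (2 * u / (1 - u) + 3 / 4) < 1 := by
      have : x k * (2 * u / (1 - u) + 3 / 4) = x k * (2 * u + 3 / 4 * (1 - u)) / (1 - u) := by
        field_simp
      rw [this, div_lt_one hden1]; exact hc
    have hcond : x k * (eb k + 3 / 4) < 1 :=
      lt_of_le_of_lt (mul_le_mul_of_nonneg_left (by linarith [heb_le]) hxk) hcondbar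
    refine ⟨hcond, ?_⟩
    -- the λ-recursion
    have hP := step_poly4 hxk hu0 hu1
    have hlamK : lam k = 4 * (x k + u) / (2 - (x k + u)) := by rw [hlamk, hZk, ← hs_def, ← hu_def]
    have hlampr : lam (pred k) * ((pred k : ℝ) / k) = eb k / 2 := by rw [heb_def]; simp only; ring
    have hlamk0 : 0 ≤ lam k := hlam0 k hk
    -- step A: replace eb by its majorant on the left
    have hA : lam (pred k) * ((pred k : ℝ) / k) * (1 + x k / 4) + x k * (1 + eb k) ≤
        u / (1 - u) * (1 + x k / 4) + x k * (1 + 2 * u / (1 - u)) := by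
      rw [hlampr]
      have h1 : eb k / 2 ≤ u / (1 - u) := by
        have : u / (1 - u) = 2 * u / (1 - u) / 2 := by ring
        rw [this]; linarith [heb_le]
      have h2 : eb k / 2 * (1 + x k / 4) ≤ u / (1 - u) * (1 + x k / 4) := mul_le_mul_of_nonneg_right h1 (by linarith)
      have h3 : x k * (1 + eb k) ≤ x k * (1 + 2 * u / (1 - u)) := mul_le_mul_of_nonneg_left (by linarith [heb_le]) hxk
      linarith
    -- step B: the cubic
    have hB : u / (1 - u) * (1 + x k / 4) + x k * (1 + 2 * u / (1 - u)) ≤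
        4 * (x k + u) / (2 - (x k + u)) * (1 - x k * (3 / 4 + 2 * u / (1 - u))) := by
      rw [← sub_nonneg]
      have hid : 4 * (x k + u) / (2 - (x k + u)) * (1 - x k * (3 / 4 + 2 * u / (1 - u))) -
          (u / (1 - u) * (1 + x k / 4) + x k * (1 + 2 * u / (1 - u))) =
          (4 * (x k + u) * ((1 - u) * (1 - 3 / 4 * x k) - 2 * u * x k) - (u * (1 + x k / 4) + x k * (1 + u)) * (2 - x k - u)) /
            ((2 - (x k + u)) * (1 - u)) := by
        field_simp
        ring
      rw [hid]
      exact div_nonneg (by linarith [hP]) (mul_pos hden2 hden1).le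
    -- step C: back to eb on the right
    have hC : 4 * (x k + u) / (2 - (x k + u)) * (1 - x k * (3 / 4 + 2 * u / (1 - u))) ≤ lam k * (1 - x k * (3 / 4 + eb k)) := by
      rw [← hlamK]
      exact mul_le_mul_of_nonneg_left (by nlinarith [mul_le_mul_of_nonneg_left heb_le hxk]) hlamk0
    exact hA.trans (hB.trans hC)
  have hμm : μ m₀ = (3 / 4 * x m₀) / (1 - 3 / 4 * x m₀) := by rw [hμ_def]; exact if_pos rfl
  have hμk : ∀ k, k ≠ m₀ → μ k = (eb k * (1 + x k) + 3 / 4 * x k) / (1 - x k * (3 / 4 + eb k)) := fun k hk => by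
    rw [hμ_def]; exact if_neg hk
  have hμ0 : ∀ k ∈ A, 0 ≤ μ k := by
    intro k hk
    by_cases hkm : k = m₀
    · have h1 := hcap m₀ hm₀
      have h2 := hx m₀ hm₀
      have e : μ k = (3 / 4 * x m₀) / (1 - 3 / 4 * x m₀) := by rw [hkm]; exact hμm
      have hnum : 0 ≤ 3 / 4 * x m₀ := mul_nonneg (by norm_num) h2
      have hden : 0 ≤ 1 - 3 / 4 * x m₀ := by
        have : 3 / 4 * x m₀ ≤ 3 / 4 * (71 / 100) := mul_le_mul_of_nonneg_left h1 (by norm_num)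
        exact sub_nonneg.mpr (this.trans (by norm_num))
      rw [e]; exact div_nonneg hnum hden
    · have h1 := heb0 k hk hkm
      have h2 := hx k hk
      have h3 := (hstep k hk hkm).1
      have h4 : 0 ≤ eb k * (1 + x k) := mul_nonneg h1 (add_nonneg zero_le_one h2)
      have h5 : 0 ≤ eb k * (1 + x k) + 3 / 4 * x k := add_nonneg h4 (mul_nonneg (by norm_num) h2)
      have h6 : x k * (3 / 4 + eb k) = x k * (eb k + 3 / 4) := by ring
      have h7 : 0 ≤ 1 - x k * (3 / 4 + eb k) := by rw [h6]; exact sub_nonneg.mpr h3.le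
      rw [hμk k hkm]; exact div_nonneg h5 h7
  refine ⟨μ, lam, hμ0, hlam0, ?_, ?_, ?_, ?_, ?_⟩
  · -- base μ
    have := hcap m₀ hm₀
    rw [hμm, div_mul_cancel₀ _ (by linarith)]
  · -- base λ: x ≤ 4x(1 - 3x/4)/(2 - x)
    have h1 := hcap m₀ hm₀; have h2 := hx m₀ hm₀
    rw [hlamk, hZm, div_mul_eq_mul_div, le_div_iff₀ (by linarith)]
    nlinarith
  · -- condition, with e ≤ eb
    intro k hk hkm
    have h1 := (hstep k hk hkm).1
    have hmin' : min (4 * (pred k : ℝ) * k / ((k : ℝ) + pred k) ^ 2 * μ (pred k)) (2 * lam (pred k) * ((pred k : ℝ) / k)) ≤ eb k := by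
      rw [heb_def]; exact min_le_right _ _
    nlinarith [mul_le_mul_of_nonneg_left hmin' (hx k hk)]
  · -- μ-recursion, by the definition of μ at eb and monotonicity in e
    intro k hk hkm
    have h1 := (hstep k hk hkm).1
    have hxk := hx k hk
    have hmin' : min (4 * (pred k : ℝ) * k / ((k : ℝ) + pred k) ^ 2 * μ (pred k)) (2 * lam (pred k) * ((pred k : ℝ) / k)) ≤ eb k := by
      rw [heb_def]; exact min_le_right _ _
    set e := min (4 * (pred k : ℝ) * k / ((k : ℝ) + pred k) ^ 2 * μ (pred k)) (2 * lam (pred k) * ((pred k : ℝ) / k)) with he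
    have heb0' := heb0 k hk hkm
    have hden : 0 < 1 - x k * (3 / 4 + eb k) := by have := h1; nlinarith [hxk, heb0']
    have hμk' : μ k * (1 - x k * (3 / 4 + eb k)) = eb k * (1 + x k) + 3 / 4 * x k := by
      rw [hμk k hkm, div_mul_cancel₀ _ hden.ne']
    have hμ0' : 0 ≤ μ k := hμ0 k hk
    have h2 : e * (1 + x k) ≤ eb k * (1 + x k) := mul_le_mul_of_nonneg_right hmin' (by linarith)
    have h3 : μ k * (1 - x k * (3 / 4 + eb k)) ≤ μ k * (1 - x k * (3 / 4 + e)) :=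
      mul_le_mul_of_nonneg_left (by nlinarith [mul_le_mul_of_nonneg_left hmin' hxk]) hμ0'
    linarith
  · -- λ-recursion, monotone in e
    intro k hk hkm
    have h2 := (hstep k hk hkm).2
    have hxk := hx k hk
    have hmin' : min (4 * (pred k : ℝ) * k / ((k : ℝ) + pred k) ^ 2 * μ (pred k)) (2 * lam (pred k) * ((pred k : ℝ) / k)) ≤ eb k := by
      rw [heb_def]; exact min_le_right _ _
    set e := min (4 * (pred k : ℝ) * k / ((k : ℝ) + pred k) ^ 2 * μ (pred k)) (2 * lam (pred k) * ((pred k : ℝ) / k)) with he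
    have h3 : x k * (1 + e) ≤ x k * (1 + eb k) := mul_le_mul_of_nonneg_left (by linarith) hxk
    have h4 : lam k * (1 - x k * (3 / 4 + eb k)) ≤ lam k * (1 - x k * (3 / 4 + e)) :=
      mul_le_mul_of_nonneg_left (by nlinarith [mul_le_mul_of_nonneg_left hmin' hxk]) (hlam0 k hk)
    linarith

end Summit.QuantumFields.BalabanUV.Beta.EriceRemainderEnclosureHistoryAutonomyComparisonTowerChainFour

end
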